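import Mathlib.Order.PiLex
import Mathlib.Data.Prod.Lex
import Literature.NumberTheory.Automorphic.ParabolicBruhatCellsGL
import HarnessLib

/-!
# The `(P_c, U_n)`-double cosets of `GL_n`: semicontinuity of the ranks and the closed filtration

Topic `NumberTheory/Automorphic`. Continuation of `ParabolicBruhatCellsGL`: there the double cosets
`P_c P_σ U_n ⊆ GL_n(K)` of a monotone block labelling `c : Fin n → α` were classified by the
south-west ranks `swRank c g a j`. Here:

* `blockCount_le_blockCount_rev` — the ranks are maximal on the **open cell** `P_c P_{w₀} U_n`,
  `w₀ = Fin.revPerm` (`blockCount c w₀ a j = min (j, #{a ≤ c i})`, `blockCount_rev`);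
* `comp_symm_eq_comp_rev_of_antitone` — a permutation whose block word `c ∘ σ⁻¹` is antitone lies
  in the open cell (antitone rearrangements are unique), so every other cell has an **ascent**
  `c (σ⁻¹ i) < c (σ⁻¹ (i+1))` (`exists_lt_or_parabolicDoubleCoset_eq_rev`);
* `cellKey c σ = (∑ ranks, block word) ∈ ℕ ×ₗ Lex (Fin n → α)` — a linear order on the cells
  (`cellKey_eq_iff`), with the open cell on top (`cellKey_le_cellKey_rev`);
* `isOpen_setOf_le_swRank` — over a topological field the ranks are **lower semicontinuous** on
  `GL_n(K)` (if `rank S ≥ m` then `W S V = 1_m` for some `V, W`, and `det (W S' V) ≠ 0` nearby);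
* `isClosed_cellsBelow` — hence for every lower set `D` of keys the union of the cells with key in
  `D` is **closed**; in particular `cellLE c σ = ⋃_{key τ ≤ key σ}` and `cellLT c σ = ⋃_{key τ < key σ}`
  are closed, `cellLE c σ = cellLT c σ ∪ P_c P_σ U_n` (disjointly), and `cellLE c w₀ = GL_n(K)`.

This is the standard stratification of `G` by closures of Bruhat cells (the closure of a cell is a
union of smaller cells: Fulton 1997, §10.2, "`Z_d = ⋃_{ℓ(w) ≤ d} X_w°` is a closed algebraic
subset"), arranged along a linear refinement of the rank sums, which is what the induction over
cells in the heredity theorem for Whittaker functionals uses. Definitions (`rankSum`, `cellKey`,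
`cellsBelow`, `cellLE`, `cellLT`) have bodies; everything else is proved; no named fact.

## References

* W. Fulton, *Young Tableaux*, CUP (1997), §10.2 (cells by the numbers `dim (E_p ∩ F_q)`; the
  unions `Z_d` of cells of bounded dimension are closed; held, PDF pp. 149–152).
  [FultonYoungTableaux1997]
* G. Malle, D. Testerman, *Linear Algebraic Groups and Finite Groups of Lie Type*, CUP (2011),
  Thm. 11.17, Prop. 12.2. [MalleTesterman2011]
-/

namespace Literature.NumberTheory.Automorphic

open Matrix

/-! ### Combinatorics of the block counts: the open cell and ascents -/

section Combinatorics

variable {n : ℕ} {α : Type*} [LinearOrder α] (c : Fin n → α)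

/-- `#{i : Fin n | m ≤ i} = n - m`. [folklore] -/
theorem card_filter_val_ge (m : ℕ) :
    (Finset.univ.filter fun i : Fin n => m ≤ (i : ℕ)).card = n - m := by
  have h : (Finset.univ.filter fun i : Fin n => m ≤ (i : ℕ)) =
      (Finset.univ.filter fun i : Fin n => (i : ℕ) < m)ᶜ := by
    ext i
    simp
  rw [h, Finset.card_compl, Fin.card_filter_val_lt, Fintype.card_fin]
  omega

/-- A function on `Fin n` which does not increase from each index to the next is antitone.
[folklore] -/
theorem antitone_of_forall_succ_le {β : Type*} [Preorder β] {f : Fin n → β}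
    (h : ∀ (i : Fin n) (hi : (i : ℕ) + 1 < n), f ⟨(i : ℕ) + 1, hi⟩ ≤ f i) : Antitone f := by
  intro i j hij
  obtain ⟨d, hd⟩ := Nat.exists_eq_add_of_le (Fin.le_def.1 hij)
  induction d generalizing j with
  | zero =>
    have : j = i := Fin.ext (by omega)
    rw [this]
  | succ d ih =>
    have hjlt := j.is_lt
    have hj' : (i : ℕ) + d < n := by omega
    have hsucc : (i : ℕ) + d + 1 < n := by omega
    have h1 : f ⟨(i : ℕ) + d + 1, hsucc⟩ ≤ f ⟨(i : ℕ) + d, hj'⟩ := h ⟨(i : ℕ) + d, hj'⟩ hsucc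
    have h2 : f ⟨(i : ℕ) + d, hj'⟩ ≤ f i :=
      ih (j := ⟨(i : ℕ) + d, hj'⟩) (Fin.le_def.2 (Nat.le_add_right _ _)) rfl
    have : j = ⟨(i : ℕ) + d + 1, hsucc⟩ := Fin.ext (by show (j : ℕ) = i + d + 1; omega)
    rw [this]
    exact h1.trans h2

/-- Beyond the last column the block counts no longer depend on the permutation:
`blockCount c σ a j = #{i : a ≤ c i}` for `n ≤ j`. [folklore] -/
theorem blockCount_of_le (σ : Equiv.Perm (Fin n)) (a : α) {j : ℕ} (hj : n ≤ j) :
    blockCount c σ a j = (Finset.univ.filter fun i : Fin n => a ≤ c i).card := by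
  unfold blockCount
  congr 1
  ext i
  simp only [Finset.mem_filter, Finset.mem_univ, true_and, and_iff_left_iff_imp]
  exact fun _ => lt_of_lt_of_le (σ i).is_lt hj

/-- Two permutations with the same block counts for the column bounds `j ≤ n` have the same block
counts. [folklore] -/
theorem blockCount_eq_of_forall_le {σ τ : Equiv.Perm (Fin n)}
    (h : ∀ a, ∀ j ≤ n, blockCount c σ a j = blockCount c τ a j) : blockCount c σ = blockCount c τ := by
  funext a j
  rcases le_or_gt j n with hj | hj
  · exact h a j hj
  · rw [blockCount_of_le c σ a hj.le, blockCount_of_le c τ a hj.le]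

/-- The block counts are bounded by the number of admissible rows: `blockCount c σ a j ≤ #{a ≤ c i}`.
[folklore] -/
theorem blockCount_le_card (σ : Equiv.Perm (Fin n)) (a : α) (j : ℕ) :
    blockCount c σ a j ≤ (Finset.univ.filter fun i : Fin n => a ≤ c i).card :=
  Finset.card_le_card (Finset.monotone_filter_right _ fun _ _ h => h.1)

/-- The block counts are bounded by the number of columns: `blockCount c σ a j ≤ j`. [folklore] -/
theorem blockCount_le (σ : Equiv.Perm (Fin n)) (a : α) (j : ℕ) : blockCount c σ a j ≤ j := by
  classical
  unfold blockCount
  calc (Finset.univ.filter fun i : Fin n => a ≤ c i ∧ ((σ i : Fin n) : ℕ) < j).card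
      ≤ (Finset.univ.filter fun i : Fin n => ((σ i : Fin n) : ℕ) < j).card :=
        Finset.card_le_card (Finset.monotone_filter_right _ fun _ _ h => h.2)
    _ = ((Finset.univ.filter fun k : Fin n => (k : ℕ) < j).map σ.symm.toEmbedding).card := by
        congr 1
        ext i
        simp only [Finset.mem_filter, Finset.mem_univ, true_and, Finset.mem_map_equiv,
          Equiv.symm_symm]
    _ = (Finset.univ.filter fun k : Fin n => (k : ℕ) < j).card := Finset.card_map _
    _ = min n j := Fin.card_filter_val_lt
    _ ≤ j := min_le_right _ _

/-- For a monotone labelling, the block counts of the **longest element** `w₀ = Fin.revPerm` are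
`blockCount c w₀ a j = min (j, #{a ≤ c i})`: the admissible rows form a final segment, whose last
`j` members are counted. [folklore] -/
theorem blockCount_rev (hc : Monotone c) (a : α) {j : ℕ} (hj : j ≤ n) :
    blockCount c Fin.revPerm a j = min j (Finset.univ.filter fun i : Fin n => a ≤ c i).card := by
  classical
  set A := Finset.univ.filter fun i : Fin n => a ≤ c i with hA
  -- the last `j` rows
  set L := Finset.univ.filter fun i : Fin n => n - j ≤ (i : ℕ) with hL
  have hLcard : L.card = j := by
    rw [hL, card_filter_val_ge]
    omega
  have hcount : blockCount c Fin.revPerm a j = (A ∩ L).card := by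
    unfold blockCount
    congr 1
    ext i
    simp only [Finset.mem_filter, Finset.mem_univ, true_and, Finset.mem_inter, hA, hL,
      Fin.revPerm_apply, Fin.val_rev]
    constructor
    · rintro ⟨h1, h2⟩
      exact ⟨h1, by omega⟩
    · rintro ⟨h1, h2⟩
      exact ⟨h1, by have := i.is_lt; omega⟩
  rw [hcount]
  rcases le_total j A.card with hjA | hjA
  · rw [min_eq_left hjA]
    suffices L ⊆ A by rw [Finset.inter_eq_right.2 this, hLcard]
    intro i hi
    simp only [hL, Finset.mem_filter, Finset.mem_univ, true_and] at hi
    by_contra hiA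
    -- `i ∉ A` forces `A ⊆ {k : i < k}` by monotonicity, a set of `n - i - 1 < j` elements
    have hsub : A ⊆ Finset.univ.filter fun k : Fin n => (i : ℕ) + 1 ≤ k := by
      intro k hk
      simp only [hA, Finset.mem_filter, Finset.mem_univ, true_and] at hk hiA ⊢
      by_contra hki
      exact hiA (hk.trans (hc (Fin.le_def.2 (by omega))))
    have := Finset.card_le_card hsub
    rw [card_filter_val_ge] at this
    have := i.is_lt
    omega
  · rw [min_eq_right hjA]
    suffices A ⊆ L by rw [Finset.inter_eq_left.2 this]
    intro i hi
    simp only [hL, Finset.mem_filter, Finset.mem_univ, true_and]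
    by_contra hiL
    -- `i ∈ A` forces `{k : i ≤ k} ⊆ A` by monotonicity, a set of `n - i > j` elements
    have hsub : (Finset.univ.filter fun k : Fin n => (i : ℕ) ≤ k) ⊆ A := by
      intro k hk
      simp only [hA, Finset.mem_filter, Finset.mem_univ, true_and] at hi hk ⊢
      exact hi.trans (hc (Fin.le_def.2 hk))
    have := Finset.card_le_card hsub
    rw [card_filter_val_ge] at this
    omega

/-- **The ranks are maximal on the open cell**: `blockCount c σ a j ≤ blockCount c w₀ a j`.
[folklore] -/
theorem blockCount_le_blockCount_rev (hc : Monotone c) (σ : Equiv.Perm (Fin n)) (a : α) (j : ℕ) :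
    blockCount c σ a j ≤ blockCount c Fin.revPerm a j := by
  rcases le_or_gt j n with hj | hj
  · rw [blockCount_rev c hc a hj]
    exact le_min (blockCount_le c σ a j) (blockCount_le_card c σ a j)
  · rw [blockCount_of_le c σ a hj.le, blockCount_of_le c _ a hj.le]

/-- **Antitone rearrangements are unique**: if the block word `c ∘ σ⁻¹` of `σ` is antitone (no
ascent) then it is the block word `c ∘ w₀` of the longest element (for a monotone `c`): the
superlevel sets of two antitone rearrangements of `c` are initial segments of the same size.
[folklore] -/
theorem comp_symm_eq_comp_rev_of_antitone (hc : Monotone c) {σ : Equiv.Perm (Fin n)}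
    (hσ : Antitone (c ∘ σ.symm)) : c ∘ σ.symm = c ∘ Fin.revPerm.symm := by
  classical
  have hrev : Antitone (c ∘ Fin.revPerm.symm) := fun i j hij => by
    simp only [Function.comp_apply, Fin.revPerm_symm, Fin.revPerm_apply]
    exact hc (Fin.rev_le_rev.2 hij)
  -- superlevel sets of a rearrangement of `c` have the cardinality of those of `c`
  have hcard : ∀ (a : α) (π : Equiv.Perm (Fin n)),
      (Finset.univ.filter fun k : Fin n => a ≤ c (π.symm k)).card =
        (Finset.univ.filter fun i : Fin n => a ≤ c i).card := by
    intro a π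
    have : (Finset.univ.filter fun k : Fin n => a ≤ c (π.symm k)) =
        (Finset.univ.filter fun i : Fin n => a ≤ c i).map π.toEmbedding := by
      ext k
      simp only [Finset.mem_filter, Finset.mem_univ, true_and, Finset.mem_map_equiv]
    rw [this, Finset.card_map]
  -- two initial segments of `Fin n` of the same cardinality coincide
  have hseg : ∀ {S T : Finset (Fin n)}, (∀ k k' : Fin n, k' ≤ k → k ∈ S → k' ∈ S) →
      (∀ k k' : Fin n, k' ≤ k → k ∈ T → k' ∈ T) → S.card = T.card → S ⊆ T := by
    intro S T hS hT hST k hk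
    by_contra hkT
    have h1 : T ⊆ Finset.univ.filter fun k' : Fin n => (k' : ℕ) < k := by
      intro k' hk'
      simp only [Finset.mem_filter, Finset.mem_univ, true_and]
      by_contra h
      exact hkT (hT k' k (Fin.le_def.2 (not_lt.1 h)) hk')
    have h2 : (Finset.univ.filter fun k' : Fin n => (k' : ℕ) < (k : ℕ) + 1) ⊆ S := by
      intro k' hk'
      simp only [Finset.mem_filter, Finset.mem_univ, true_and] at hk'
      exact hS k k' (Fin.le_def.2 (by omega)) hk
    have h1' := Finset.card_le_card h1
    have h2' := Finset.card_le_card h2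
    rw [Fin.card_filter_val_lt] at h1' h2'
    have := k.is_lt
    omega
  have key : ∀ {f g : Fin n → α}, Antitone f → Antitone g →
      (∀ a, (Finset.univ.filter fun k => a ≤ f k).card = (Finset.univ.filter fun k => a ≤ g k).card) →
      ∀ k, f k ≤ g k := by
    intro f g hf hg hfg k
    have hsub := hseg (S := Finset.univ.filter fun k' => f k ≤ f k')
      (T := Finset.univ.filter fun k' => f k ≤ g k') ?_ ?_ (hfg (f k))
    · have hk : k ∈ Finset.univ.filter fun k' => f k ≤ f k' := by simp
      simpa using hsub hk
    · intro k₁ k₂ h12 h1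
      simp only [Finset.mem_filter, Finset.mem_univ, true_and] at h1 ⊢
      exact h1.trans (hf h12)
    · intro k₁ k₂ h12 h1
      simp only [Finset.mem_filter, Finset.mem_univ, true_and] at h1 ⊢
      exact h1.trans (hg h12)
  have hcard' : ∀ (a : α) (π : Equiv.Perm (Fin n)),
      (Finset.univ.filter fun k : Fin n => a ≤ (c ∘ π.symm) k).card =
        (Finset.univ.filter fun i : Fin n => a ≤ c i).card := fun a π => hcard a π
  funext k
  exact le_antisymm (key hσ hrev (fun a => by rw [hcard' a σ, hcard' a Fin.revPerm]) k)
    (key hrev hσ (fun a => by rw [hcard' a Fin.revPerm, hcard' a σ]) k)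

variable {K : Type*} [Field K]

/-- Equal block words give equal double cosets (no monotonicity needed). [folklore] -/
theorem parabolicDoubleCoset_eq_of_comp_symm_eq {σ τ : Equiv.Perm (Fin n)}
    (h : c ∘ σ.symm = c ∘ τ.symm) :
    parabolicDoubleCoset (K := K) c σ = parabolicDoubleCoset (K := K) c τ := by
  have key : ∀ {σ τ : Equiv.Perm (Fin n)}, c ∘ σ.symm = c ∘ τ.symm →
      parabolicDoubleCoset (K := K) c σ ⊆ parabolicDoubleCoset (K := K) c τ := by
    intro σ τ h g hg
    obtain ⟨p, hp, u, hu, rfl⟩ := hg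
    obtain ⟨p', hp', hσ⟩ := permGL_eq_parabolic_mul_permGL (K := K) c h
    exact ⟨p * p', Subgroup.mul_mem _ hp hp', u, hu, by rw [hσ]; group⟩
  exact le_antisymm (key h) (key h.symm)

/-- **Every cell other than the open one has an ascent**: either the block word of `σ` ascends
somewhere, `c (σ⁻¹ i) < c (σ⁻¹ (i+1))` — so that conjugation by `P_σ` moves the simple root group
`U_{i,i+1}` into the unipotent radical of `P_c` — or `P_c P_σ U_n` is the open cell `P_c P_{w₀} U_n`.
[folklore] -/
theorem exists_lt_or_parabolicDoubleCoset_eq_rev (hc : Monotone c) (σ : Equiv.Perm (Fin n)) :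
    (∃ i : Fin n, ∃ h : (i : ℕ) + 1 < n, c (σ.symm i) < c (σ.symm ⟨(i : ℕ) + 1, h⟩)) ∨
      parabolicDoubleCoset (K := K) c σ = parabolicDoubleCoset (K := K) c Fin.revPerm := by
  by_cases h : ∃ i : Fin n, ∃ h : (i : ℕ) + 1 < n, c (σ.symm i) < c (σ.symm ⟨(i : ℕ) + 1, h⟩)
  · exact Or.inl h
  · right
    simp only [not_exists, not_lt] at h
    have hanti : Antitone (c ∘ σ.symm) := antitone_of_forall_succ_le fun i hi => h i hi
    exact parabolicDoubleCoset_eq_of_comp_symm_eq c (comp_symm_eq_comp_rev_of_antitone c hc hanti)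

/-! ### The linear order on the cells -/

variable [Fintype α]

/-- The **rank sum** of a permutation: `∑_{a} ∑_{j ≤ n} blockCount c σ a j`. [folklore] -/
def rankSum (σ : Equiv.Perm (Fin n)) : ℕ :=
  ∑ a : α, ∑ j ∈ Finset.range (n + 1), blockCount c σ a j

/-- The **key** of the cell of `σ`: its rank sum, then its block word `c ∘ σ⁻¹` in the
lexicographic order — an element of the linear order `ℕ ×ₗ Lex (Fin n → α)`. Equal keys = equal
cells (`cellKey_eq_iff`); the order refines the rank sums, so closures of cells only meet cells of
smaller key (`isClosed_cellsBelow`). [folklore] -/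
def cellKey (σ : Equiv.Perm (Fin n)) : ℕ ×ₗ Lex (Fin n → α) :=
  toLex (rankSum c σ, toLex (c ∘ σ.symm))

omit [Fintype α] in
/-- A permutation matrix lying in a double coset has its block counts. [folklore] -/
theorem blockCount_eq_of_permGL_mem {σ τ : Equiv.Perm (Fin n)}
    (h : (permGL τ : GL (Fin n) K) ∈ parabolicDoubleCoset (K := K) c σ) :
    blockCount c τ = blockCount c σ := by
  obtain ⟨p, hp, u, hu, hτ⟩ := h
  have h1 := swRank_parabolic_mul_permGL_mul (K := K) c hp σ hu
  rw [← hτ] at h1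
  rw [← h1]
  funext a j
  rw [coe_permGL, swRank_permMatrix]

/-- **Equal keys, equal cells.** [folklore] -/
theorem cellKey_eq_iff {σ τ : Equiv.Perm (Fin n)} :
    cellKey c σ = cellKey c τ ↔
      parabolicDoubleCoset (K := K) c σ = parabolicDoubleCoset (K := K) c τ := by
  constructor
  · intro h
    have h2 : c ∘ σ.symm = c ∘ τ.symm := by
      have := congrArg (fun x => (ofLex x).2) h
      simpa [cellKey] using this
    exact parabolicDoubleCoset_eq_of_comp_symm_eq c h2
  · intro h
    have hb : blockCount c τ = blockCount c σ :=
      blockCount_eq_of_permGL_mem c (h ▸ permGL_mem_parabolicDoubleCoset (K := K) c τ)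
    have hw : c ∘ τ.symm = c ∘ σ.symm := comp_symm_eq_of_blockCount_eq c hb
    simp only [cellKey, rankSum, hb, hw]

/-- The rank sum is the first component of the key: `key σ ≤ key τ → rankSum σ ≤ rankSum τ`.
[folklore] -/
theorem rankSum_le_of_cellKey_le {σ τ : Equiv.Perm (Fin n)} (h : cellKey c σ ≤ cellKey c τ) :
    rankSum c σ ≤ rankSum c τ := by
  rcases Prod.Lex.le_iff.1 h with h | ⟨h, -⟩
  · exact le_of_lt h
  · exact le_of_eq h

/-- **Componentwise larger block counts with no larger rank sum are equal.** [folklore] -/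
theorem blockCount_eq_of_le_of_rankSum_le {σ τ : Equiv.Perm (Fin n)}
    (hle : ∀ a, ∀ j ≤ n, blockCount c σ a j ≤ blockCount c τ a j) (hsum : rankSum c τ ≤ rankSum c σ) :
    blockCount c σ = blockCount c τ := by
  have hle' : ∀ a ∈ (Finset.univ : Finset α), ∑ j ∈ Finset.range (n + 1), blockCount c σ a j ≤
      ∑ j ∈ Finset.range (n + 1), blockCount c τ a j :=
    fun a _ => Finset.sum_le_sum fun j hj => hle a j (Nat.lt_succ_iff.1 (Finset.mem_range.1 hj))
  have heq : rankSum c σ = rankSum c τ := le_antisymm (Finset.sum_le_sum hle') hsum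
  have h1 := (Finset.sum_eq_sum_iff_of_le hle').1 heq
  refine blockCount_eq_of_forall_le c fun a j hj => ?_
  have h2 := (Finset.sum_eq_sum_iff_of_le fun j hj =>
    hle a j (Nat.lt_succ_iff.1 (Finset.mem_range.1 hj))).1 (h1 a (Finset.mem_univ a))
  exact h2 j (Finset.mem_range.2 (Nat.lt_succ_iff.2 hj))

/-- **The open cell has the largest key**: `cellKey c σ ≤ cellKey c w₀` for monotone `c`. [folklore] -/
theorem cellKey_le_cellKey_rev (hc : Monotone c) (σ : Equiv.Perm (Fin n)) :
    cellKey c σ ≤ cellKey c Fin.revPerm := by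
  have hle : ∀ a, ∀ j ≤ n, blockCount c σ a j ≤ blockCount c Fin.revPerm a j :=
    fun a j _ => blockCount_le_blockCount_rev c hc σ a j
  rcases lt_or_ge (rankSum c σ) (rankSum c Fin.revPerm) with h | h
  · exact le_of_lt (Prod.Lex.lt_iff.2 (Or.inl h))
  · have hb := blockCount_eq_of_le_of_rankSum_le c hle h
    have hw := comp_symm_eq_of_blockCount_eq c hb
    apply le_of_eq
    simp only [cellKey, rankSum, hb, hw]

/-! ### Unions of cells below a key -/

/-- The union of the cells whose key lies in a set `D` of keys. [folklore] -/
def cellsBelow (D : Set (ℕ ×ₗ Lex (Fin n → α))) : Set (GL (Fin n) K) :=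
  {g | ∃ τ : Equiv.Perm (Fin n), cellKey c τ ∈ D ∧ g ∈ parabolicDoubleCoset (K := K) c τ}

/-- `cellLE c σ = ⋃_{key τ ≤ key σ} P_c P_τ U_n`. [folklore] -/
def cellLE (σ : Equiv.Perm (Fin n)) : Set (GL (Fin n) K) := cellsBelow (K := K) c (Set.Iic (cellKey c σ))

/-- `cellLT c σ = ⋃_{key τ < key σ} P_c P_τ U_n`. [folklore] -/
def cellLT (σ : Equiv.Perm (Fin n)) : Set (GL (Fin n) K) := cellsBelow (K := K) c (Set.Iio (cellKey c σ))

/-- Membership in `cellsBelow`. [folklore] -/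
lemma mem_cellsBelow_iff (D : Set (ℕ ×ₗ Lex (Fin n → α))) (g : GL (Fin n) K) :
    g ∈ cellsBelow (K := K) c D ↔ ∃ τ, cellKey c τ ∈ D ∧ g ∈ parabolicDoubleCoset (K := K) c τ :=
  Iff.rfl

/-- `cellsBelow` is monotone in the set of keys. [folklore] -/
lemma cellsBelow_mono {D D' : Set (ℕ ×ₗ Lex (Fin n → α))} (h : D ⊆ D') :
    cellsBelow (K := K) c D ⊆ cellsBelow (K := K) c D' :=
  fun _ ⟨τ, hτ, hg⟩ => ⟨τ, h hτ, hg⟩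

/-- `cellsBelow` is stable under `g ↦ p g u`, `p ∈ P_c`, `u ∈ U_n`. [folklore] -/
lemma mul_mul_mem_cellsBelow {D : Set (ℕ ×ₗ Lex (Fin n → α))} {g : GL (Fin n) K}
    (hg : g ∈ cellsBelow (K := K) c D) {p : GL (Fin n) K} (hp : p ∈ standardParabolicGL K c)
    {u : GL (Fin n) K} (hu : u ∈ upperUnitriangular (Fin n) K) :
    p * g * u ∈ cellsBelow (K := K) c D := by
  obtain ⟨τ, hτ, hg⟩ := hg
  exact ⟨τ, hτ, mul_mul_mem_parabolicDoubleCoset c hg hp hu⟩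

/-- A cell whose key lies in `D` is contained in `cellsBelow c D`. [folklore] -/
lemma parabolicDoubleCoset_subset_cellsBelow {D : Set (ℕ ×ₗ Lex (Fin n → α))}
    {τ : Equiv.Perm (Fin n)} (hτ : cellKey c τ ∈ D) :
    parabolicDoubleCoset (K := K) c τ ⊆ cellsBelow (K := K) c D :=
  fun _ hg => ⟨τ, hτ, hg⟩

/-- A cell whose key does not lie in `D` is disjoint from `cellsBelow c D`. [folklore] -/
lemma disjoint_parabolicDoubleCoset_cellsBelow (hc : Monotone c) {D : Set (ℕ ×ₗ Lex (Fin n → α))}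
    {σ : Equiv.Perm (Fin n)} (hσ : cellKey c σ ∉ D) :
    Disjoint (parabolicDoubleCoset (K := K) c σ) (cellsBelow (K := K) c D) := by
  rw [Set.disjoint_left]
  rintro g hg ⟨τ, hτ, hg'⟩
  rcases parabolicDoubleCoset_eq_or_disjoint (K := K) c hc σ τ with h | h
  · rw [← (cellKey_eq_iff (K := K) c).2 h] at hτ
    exact hσ hτ
  · exact Set.disjoint_left.1 h hg hg'

/-- `cellLE c σ = cellLT c σ ∪ P_c P_σ U_n`. [folklore] -/
theorem cellLE_eq_cellLT_union (σ : Equiv.Perm (Fin n)) :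
    cellLE (K := K) c σ = cellLT (K := K) c σ ∪ parabolicDoubleCoset (K := K) c σ := by
  ext g
  simp only [cellLE, cellLT, mem_cellsBelow_iff, Set.mem_Iic, Set.mem_Iio, Set.mem_union]
  constructor
  · rintro ⟨τ, hτ, hg⟩
    rcases hτ.lt_or_eq with h | h
    · exact Or.inl ⟨τ, h, hg⟩
    · exact Or.inr (((cellKey_eq_iff (K := K) c).1 h) ▸ hg)
  · rintro (⟨τ, hτ, hg⟩ | hg)
    · exact ⟨τ, hτ.le, hg⟩
    · exact ⟨σ, le_rfl, hg⟩

/-- `cellLT c σ` misses the cell of `σ`. [folklore] -/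
theorem disjoint_cellLT_parabolicDoubleCoset (hc : Monotone c) (σ : Equiv.Perm (Fin n)) :
    Disjoint (cellLT (K := K) c σ) (parabolicDoubleCoset (K := K) c σ) :=
  (disjoint_parabolicDoubleCoset_cellsBelow (K := K) c hc (σ := σ) (D := Set.Iio (cellKey c σ))
    (fun h => lt_irrefl _ (Set.mem_Iio.1 h))).symm

/-- `cellLE c σ \ cellLT c σ = P_c P_σ U_n`. [folklore] -/
theorem cellLE_diff_cellLT (hc : Monotone c) (σ : Equiv.Perm (Fin n)) :
    cellLE (K := K) c σ \ cellLT (K := K) c σ = parabolicDoubleCoset (K := K) c σ := by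
  ext g
  rw [cellLE_eq_cellLT_union, Set.mem_sdiff, Set.mem_union]
  constructor
  · rintro ⟨h | h, h'⟩
    · exact absurd h h'
    · exact h
  · intro h
    exact ⟨Or.inr h, fun h' =>
      Set.disjoint_left.1 (disjoint_cellLT_parabolicDoubleCoset (K := K) c hc σ) h' h⟩

/-- `cellLT c τ ⊆ cellLE c τ`. [folklore] -/
lemma cellLT_subset_cellLE (σ : Equiv.Perm (Fin n)) : cellLT (K := K) c σ ⊆ cellLE (K := K) c σ :=
  cellsBelow_mono c Set.Iio_subset_Iic_self

/-- `cellLE c τ ⊆ cellLT c σ` when `key τ < key σ`. [folklore] -/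
lemma cellLE_subset_cellLT {σ τ : Equiv.Perm (Fin n)} (h : cellKey c τ < cellKey c σ) :
    cellLE (K := K) c τ ⊆ cellLT (K := K) c σ :=
  cellsBelow_mono c fun _ hx => lt_of_le_of_lt (Set.mem_Iic.1 hx) h

/-- **The open cell is on top**: `cellLE c w₀ = GL_n(K)` for monotone `c`. [folklore] -/
theorem cellLE_rev_eq_univ (hc : Monotone c) : cellLE (K := K) c Fin.revPerm = Set.univ := by
  refine Set.eq_univ_of_forall fun g => ?_
  obtain ⟨p, τ, u, hp, rfl⟩ := exists_eq_parabolic_mul_permGL_mul_upperUnitriangular hc g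
  exact ⟨τ, cellKey_le_cellKey_rev c hc τ, p, hp, u, u.2, rfl⟩

/-- Below the open cell: `cellLT c w₀ ∪ P_c P_{w₀} U_n = GL_n(K)`. [folklore] -/
theorem cellLT_rev_union (hc : Monotone c) :
    cellLT (K := K) c Fin.revPerm ∪ parabolicDoubleCoset (K := K) c Fin.revPerm = Set.univ := by
  rw [← cellLE_eq_cellLT_union, cellLE_rev_eq_univ c hc]

/-- If some cell lies strictly below `σ`, then `cellLT c σ = cellLE c σ'` for the cell `σ'` of
largest key below `σ`. [folklore] -/
theorem exists_cellLT_eq_cellLE {σ : Equiv.Perm (Fin n)} (h : ∃ τ, cellKey c τ < cellKey c σ) :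
    ∃ σ' : Equiv.Perm (Fin n), cellKey c σ' < cellKey c σ ∧
      cellLT (K := K) c σ = cellLE (K := K) c σ' := by
  classical
  obtain ⟨σ', hσ'mem, hmax⟩ := Finset.exists_max_image
    (Finset.univ.filter fun τ : Equiv.Perm (Fin n) => cellKey c τ < cellKey c σ) (cellKey c)
    (let ⟨τ, hτ⟩ := h; ⟨τ, Finset.mem_filter.2 ⟨Finset.mem_univ _, hτ⟩⟩)
  have hσ' : cellKey c σ' < cellKey c σ := (Finset.mem_filter.1 hσ'mem).2
  refine ⟨σ', hσ', Set.Subset.antisymm ?_ (cellLE_subset_cellLT c hσ')⟩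
  rintro g ⟨τ, hτ, hg⟩
  exact ⟨τ, hmax τ (Finset.mem_filter.2 ⟨Finset.mem_univ _, hτ⟩), hg⟩

/-- If no cell lies strictly below `σ`, then `cellLT c σ = ∅`. [folklore] -/
theorem cellLT_eq_empty {σ : Equiv.Perm (Fin n)} (h : ¬ ∃ τ, cellKey c τ < cellKey c σ) :
    cellLT (K := K) c σ = ∅ := by
  ext g
  simp only [cellLT, mem_cellsBelow_iff, Set.mem_Iio, Set.mem_empty_iff_false, iff_false]
  rintro ⟨τ, hτ, -⟩
  exact h ⟨τ, hτ⟩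

end Combinatorics

/-! ### Lower semicontinuity of the ranks and closedness of the filtration -/

section Topology

variable {K : Type*} [Field K] [TopologicalSpace K] [IsTopologicalRing K] [T1Space K]
  {n : ℕ} {α : Type*} [LinearOrder α] (c : Fin n → α)

omit [TopologicalSpace K] [IsTopologicalRing K] [T1Space K] in
/-- If a matrix has rank `≥ m` then some `m × m` "compression" `W S V` of it is the identity.
[folklore] -/
theorem exists_mul_mul_eq_one_of_le_rank {R C : Type*} [Fintype R] [Fintype C] [DecidableEq R]
    [DecidableEq C] (S : Matrix R C K) {m : ℕ} (hm : m ≤ S.rank) :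
    ∃ (V : Matrix C (Fin m) K) (W : Matrix (Fin m) R K), W * S * V = 1 := by
  classical
  set f : (C → K) →ₗ[K] (R → K) := Matrix.toLin' S with hf
  have hrank : S.rank = Module.finrank K (LinearMap.range f) := by
    rw [hf, Matrix.toLin'_apply']
    rfl
  rw [hrank] at hm
  set b := Module.finBasis K (LinearMap.range f)
  -- preimages of `m` independent vectors of the range
  have hx : ∀ i : Fin m, ∃ x : C → K, f x = (b (Fin.castLE hm i) : R → K) := fun i =>
    LinearMap.mem_range.1 (b (Fin.castLE hm i)).2
  choose x hx using hx
  set φ : (Fin m → K) →ₗ[K] (C → K) := (Pi.basisFun K (Fin m)).constr K x with hφ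
  have hφx : ∀ i, φ (Pi.single i 1) = x i := fun i => by
    rw [hφ, ← Pi.basisFun_apply, Module.Basis.constr_basis]
  have hinj : LinearMap.ker (f ∘ₗ φ) = ⊥ := by
    rw [LinearMap.ker_eq_bot']
    intro v hv
    have hli : LinearIndependent K (fun i : Fin m => b (Fin.castLE hm i)) :=
      b.linearIndependent.comp _ (Fin.castLE_injective hm)
    have hv_eq : v = ∑ i, v i • (Pi.single i (1 : K) : Fin m → K) := by
      conv_lhs => rw [← (Pi.basisFun K (Fin m)).sum_repr v]
      simp only [Pi.basisFun_repr, Pi.basisFun_apply]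
    have hfv : (f ∘ₗ φ) v = ∑ i, v i • (b (Fin.castLE hm i) : R → K) := by
      conv_lhs => rw [hv_eq, map_sum]
      simp only [map_smul, LinearMap.comp_apply, hφx, hx]
    have hv' : ∑ i, v i • b (Fin.castLE hm i) = 0 := by
      apply Subtype.ext
      have h1 : ((∑ i, v i • b (Fin.castLE hm i) : LinearMap.range f) : R → K) =
          ∑ i, v i • (b (Fin.castLE hm i) : R → K) := by
        rw [Submodule.coe_sum]
        simp only [Submodule.coe_smul]
      rw [h1, Submodule.coe_zero, ← hfv, hv]
    funext i
    exact Fintype.linearIndependent_iff.1 hli v hv' i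
  obtain ⟨ρ, hρ⟩ := LinearMap.exists_leftInverse_of_injective _ hinj
  refine ⟨LinearMap.toMatrix' φ, LinearMap.toMatrix' ρ, ?_⟩
  have hS : S = LinearMap.toMatrix' f := by rw [hf, LinearMap.toMatrix'_toLin']
  rw [hS, ← LinearMap.toMatrix'_comp, ← LinearMap.toMatrix'_comp, LinearMap.comp_assoc, hρ,
    LinearMap.toMatrix'_id]

/-- **Lower semicontinuity of the south-west ranks**: `{g : m ≤ swRank c g a j}` is open in
`GL_n(K)` for a (Hausdorff) topological field `K`. [folklore] -/
theorem isOpen_setOf_le_swRank (a : α) (j m : ℕ) :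
    IsOpen {g : GL (Fin n) K | m ≤ swRank c (g : Matrix (Fin n) (Fin n) K) a j} := by
  classical
  rw [isOpen_iff_mem_nhds]
  intro g₀ hg₀
  obtain ⟨V, W, hVW⟩ := exists_mul_mul_eq_one_of_le_rank (swBlock c (g₀ : Matrix (Fin n) (Fin n) K) a j) hg₀
  -- the open set `{g : det (W · swBlock g · V) ≠ 0}` contains `g₀` and lies in our set
  have hcont : Continuous fun g : GL (Fin n) K =>
      (W * swBlock c (g : Matrix (Fin n) (Fin n) K) a j * V).det := by
    refine Continuous.matrix_det ?_
    refine (continuous_const.matrix_mul ?_).matrix_mul continuous_const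
    exact (Units.continuous_val.matrix_submatrix _ _)
  have hO : IsOpen ((fun g : GL (Fin n) K =>
      (W * swBlock c (g : Matrix (Fin n) (Fin n) K) a j * V).det) ⁻¹' ({0}ᶜ : Set K)) :=
    (isOpen_compl_singleton (x := (0 : K))).preimage hcont
  have h0 : g₀ ∈ (fun g : GL (Fin n) K =>
      (W * swBlock c (g : Matrix (Fin n) (Fin n) K) a j * V).det) ⁻¹' ({0}ᶜ : Set K) := by
    show (W * swBlock c (g₀ : Matrix (Fin n) (Fin n) K) a j * V).det ∈ ({0} : Set K)ᶜ
    rw [hVW, Matrix.det_one]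
    exact one_ne_zero
  refine Filter.mem_of_superset (hO.mem_nhds h0) ?_
  · intro g hg
    simp only [Set.mem_preimage, Set.mem_compl_iff, Set.mem_singleton_iff] at hg
    have hunit : IsUnit (W * swBlock c (g : Matrix (Fin n) (Fin n) K) a j * V) :=
      (Matrix.isUnit_iff_isUnit_det _).2 (isUnit_iff_ne_zero.2 hg)
    have h1 := Matrix.rank_of_isUnit _ hunit
    rw [Fintype.card_fin] at h1
    show m ≤ (swBlock c (g : Matrix (Fin n) (Fin n) K) a j).rank
    calc m = (W * swBlock c (g : Matrix (Fin n) (Fin n) K) a j * V).rank := h1.symm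
      _ ≤ (W * swBlock c (g : Matrix (Fin n) (Fin n) K) a j).rank := Matrix.rank_mul_le_left _ _
      _ ≤ (swBlock c (g : Matrix (Fin n) (Fin n) K) a j).rank := Matrix.rank_mul_le_right _ _

variable [Fintype α]

/-- **The unions of cells below a lower set of keys are closed.** If `D` is a lower set of keys
then `cellsBelow c D` is closed in `GL_n(K)`: near a point `g` of the cell of `τ₀ ∉ D` all ranks are
at least those of `g` (semicontinuity), so a nearby cell `τ` with `key τ ∈ D`, hence
`key τ < key τ₀` and `rankSum τ ≤ rankSum τ₀`, would have the block counts of `τ₀` — the same cell.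
(The closure of a Bruhat cell is a union of smaller cells; Fulton 1997, §10.2.)
[cite: FultonYoungTableaux1997, §10.2 (PDF p. 152)] -/
theorem isClosed_cellsBelow (hc : Monotone c) {D : Set (ℕ ×ₗ Lex (Fin n → α))} (hD : IsLowerSet D) :
    IsClosed (cellsBelow (K := K) c D) := by
  classical
  rw [← isOpen_compl_iff, isOpen_iff_mem_nhds]
  intro g hg
  obtain ⟨τ₀, hτ₀⟩ := exists_swRank_eq_blockCount (K := K) c hc g
  have hgτ₀ : g ∈ parabolicDoubleCoset (K := K) c τ₀ :=
    (mem_parabolicDoubleCoset_iff_swRank_eq (K := K) c hc τ₀ g).2 hτ₀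
  have hτ₀D : cellKey c τ₀ ∉ D := fun h => hg ⟨τ₀, h, hgτ₀⟩
  -- the neighbourhood where all ranks are at least those of `g`
  set N : Set (GL (Fin n) K) := ⋂ a : α, ⋂ j ∈ Finset.range (n + 1),
    {g' : GL (Fin n) K | swRank c (g : Matrix (Fin n) (Fin n) K) a j ≤
      swRank c (g' : Matrix (Fin n) (Fin n) K) a j} with hN
  have hNopen : IsOpen N :=
    isOpen_iInter_of_finite fun a => isOpen_biInter_finset fun j _ => isOpen_setOf_le_swRank c a j _
  have hgN : g ∈ N := by
    simp only [hN, Set.mem_iInter, Set.mem_setOf_eq]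
    exact fun _ _ _ => le_rfl
  refine Filter.mem_of_superset (hNopen.mem_nhds hgN) ?_
  rintro g' hg' ⟨τ, hτD, hg'τ⟩
  have hτ : swRank c (g' : Matrix (Fin n) (Fin n) K) = blockCount c τ :=
    (mem_parabolicDoubleCoset_iff_swRank_eq (K := K) c hc τ g').1 hg'τ
  simp only [hN, Set.mem_iInter, Set.mem_setOf_eq] at hg'
  have hle : ∀ a, ∀ j ≤ n, blockCount c τ₀ a j ≤ blockCount c τ a j := by
    intro a j hj
    have := hg' a j (Finset.mem_range.2 (Nat.lt_succ_iff.2 hj))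
    rwa [hτ₀, hτ] at this
  -- `key τ₀ ≤ key τ` is impossible (`D` is a lower set), so `key τ < key τ₀`, `rankSum τ ≤ rankSum τ₀`
  have hlt : cellKey c τ < cellKey c τ₀ := lt_of_not_ge fun h => hτ₀D (hD h hτD)
  have hb := blockCount_eq_of_le_of_rankSum_le c hle (rankSum_le_of_cellKey_le c hlt.le)
  have hw := comp_symm_eq_of_blockCount_eq c hb
  have : cellKey c τ₀ = cellKey c τ := by simp only [cellKey, rankSum, hb, hw]
  exact absurd this hlt.ne'

/-- `cellLE c σ` is closed. [folklore] -/
theorem isClosed_cellLE (hc : Monotone c) (σ : Equiv.Perm (Fin n)) : IsClosed (cellLE (K := K) c σ) :=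
  isClosed_cellsBelow c hc (isLowerSet_Iic _)

/-- `cellLT c σ` is closed. [folklore] -/
theorem isClosed_cellLT (hc : Monotone c) (σ : Equiv.Perm (Fin n)) : IsClosed (cellLT (K := K) c σ) :=
  isClosed_cellsBelow c hc (isLowerSet_Iio _)

/-- **The cells are locally closed**: `P_c P_σ U_n` is (relatively) open in the closed set
`cellLE c σ`, being the complement of the closed `cellLT c σ` there. [folklore] -/
theorem isOpen_parabolicDoubleCoset_preimage_cellLE (hc : Monotone c) (σ : Equiv.Perm (Fin n)) :
    IsOpen ((Subtype.val : cellLE (K := K) c σ → GL (Fin n) K) ⁻¹' parabolicDoubleCoset (K := K) c σ) := by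
  have : ((Subtype.val : cellLE (K := K) c σ → GL (Fin n) K) ⁻¹' parabolicDoubleCoset (K := K) c σ) =
      ((Subtype.val : cellLE (K := K) c σ → GL (Fin n) K) ⁻¹' cellLT (K := K) c σ)ᶜ := by
    ext ⟨g, hg⟩
    simp only [Set.mem_preimage, Set.mem_compl_iff]
    rw [cellLE_eq_cellLT_union] at hg
    constructor
    · intro h h'
      exact Set.disjoint_left.1 (disjoint_cellLT_parabolicDoubleCoset (K := K) c hc σ) h' h
    · intro h
      exact hg.resolve_left h
  rw [this, isOpen_compl_iff]
  exact (isClosed_cellLT c hc σ).preimage continuous_subtype_val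

/-- The open cell `P_c P_{w₀} U_n` is open in `GL_n(K)`. [folklore] -/
theorem isOpen_parabolicDoubleCoset_rev (hc : Monotone c) :
    IsOpen (parabolicDoubleCoset (K := K) c Fin.revPerm) := by
  have : parabolicDoubleCoset (K := K) c Fin.revPerm = (cellLT (K := K) c Fin.revPerm)ᶜ := by
    rw [eq_compl_iff_isCompl]
    exact ⟨(disjoint_cellLT_parabolicDoubleCoset (K := K) c hc _).symm,
      codisjoint_iff.2 (by rw [sup_comm]; exact cellLT_rev_union (K := K) c hc)⟩
  rw [this, isOpen_compl_iff]
  exact isClosed_cellLT c hc _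

end Topology

end Literature.NumberTheory.Automorphic
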